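import Mathlib
import Summits.Ventures.PercRepro2.RootCutTheorem
import Summits.Ventures.PercRepro2.CutRootsA3States

/-!
# The roots and `a₃` behind an unmarked cut vertex, II: the class, the factorisation and the
theorem (blind cell PercRepro2, p3 g3, 2026-08-25; `proofs/P3-BRIDGE.md` §11.7)

CLASS (`CutRootsA3`): an unmarked cut vertex `c` of the support `z ∪ F` separates `VH ∋ a₁, a₂, a₃`
from `VL ∋ o, b`.  On the support every copy has the state `glued5` (`st_eq_glued5`), so `K₃` is the
four-monomial expansion of `CutRootsA3States.lean` (`K3_eq_cutRootsA3`) and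
`typedCount F z τ K₃ = [cHS · S_same + (cH1 + cH2 + cH3) · S_cross] · (inert)` with `S_same ≥ S_cross ≥ 0`
the typed Harris pair of the far side at the root `c` (`sSame_sub_sCross_nonneg`) and the root-side
counts `cHS ≥ 0`, `cHS + cH1 + cH2 + cH3 ≥ 0` (`symS_nonneg`, `symS_add_symC_nonneg` on the valid bit
vectors `hst5`).  THEOREM `typedCount_nonneg_of_cutRootsA3`; residual conjunct `HasCutRootsA3` with
`typedCount_nonneg_of_hasCutRootsA3`.  Own work; standard axioms.
-/

namespace Summit.Ventures.PercRepro2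

open UnionCluster

namespace CovForm

namespace RootBridge

open OneTyped TypedA3 Untouched TypedFactor Separated

/-! ## The class and the states of the support -/

section Support

open Classical

variable {V : Type*} {E : Type*} [Fintype E] [DecidableEq E]
variable (ends : E → Sym2 V) (o a₁ a₂ a₃ b c : V)

/-- **The roots and `a₃` behind an unmarked cut vertex `c`**: the support graph `z ∪ F` splits into
a side `VH ∋ a₁, a₂, a₃` and a side `VL ∋ o, b` meeting only in `c`, no typed edge inside both
sides, `c` none of the five marks. -/
structure CutRootsA3 (VL VH : Set V) (F : Finset E) (z : Config E) : Prop where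
  split : ∀ e, zF F z e = true → e ∈ within ends VL ∨ e ∈ within ends VH
  cap : ∀ t, t ∈ VL → t ∈ VH → t = c
  noloop : ∀ e ∈ F, ¬ (e ∈ within ends VL ∧ e ∈ within ends VH)
  cL : c ∈ VL
  cH : c ∈ VH
  a1H : a₁ ∈ VH
  a2H : a₂ ∈ VH
  a3H : a₃ ∈ VH
  oL : o ∈ VL
  bL : b ∈ VL
  a1c : a₁ ≠ c
  a2c : a₂ ≠ c
  a3c : a₃ ≠ c
  oc : o ≠ c
  bc : b ≠ c

omit [Fintype E] in
/-- A configuration below `z ∪ F` has its open edges within a side. -/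
lemma CutRootsA3.split_of_le {VL VH : Set V} {F : Finset E} {z : Config E}
    (h : CutRootsA3 ends o a₁ a₂ a₃ b c VL VH F z) {x : Config E} (hx : x ≤ zF F z) :
    ∀ e, x e = true → e ∈ within ends VL ∨ e ∈ within ends VH := fun e he =>
  h.split e (by have := hx e; rw [he] at this; exact Bool.eq_true_of_true_le this)

/-- The five root-side bits of a configuration, read inside `VH`. -/
noncomputable def hst5 (VH : Set V) (x : Config E) : H5 :=
  (decide (Conn ends (withinRestr ends VH x) a₁ a₂), decide (Conn ends (withinRestr ends VH x) a₁ c),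
    decide (Conn ends (withinRestr ends VH x) a₂ c), decide (Conn ends (withinRestr ends VH x) a₁ a₃),
    decide (Conn ends (withinRestr ends VH x) a₂ a₃))

omit [Fintype E] [DecidableEq E] in
/-- A transitivity implication as a Boolean clause. -/
lemma imp_clause (A B C : Prop) [Decidable A] [Decidable B] [Decidable C] (h : A → B → C) :
    (!(decide A && decide B) || decide C) = true := by
  by_cases hA : A <;> by_cases hB : B <;> simp [hA, hB]
  exact h hA hB

omit [Fintype E] [DecidableEq E] in
/-- **The root-side bits are valid**: transitivity of the connection relation. -/
lemma hst5_valid (VH : Set V) (x : Config E) : Valid5 (hst5 ends a₁ a₂ a₃ c VH x) = true := by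
  unfold Valid5 hst5 H5.ρ H5.α₁ H5.α₂ H5.lam3 H5.eta3
  simp only [Bool.and_eq_true]
  refine ⟨⟨⟨⟨⟨?_, ?_⟩, ?_⟩, ?_⟩, ?_⟩, ?_⟩
  · exact imp_clause _ _ _ fun h1 h2 => conn_trans h1 (conn_symm h2)
  · exact imp_clause _ _ _ fun h1 h2 => conn_trans (conn_symm h2) h1
  · exact imp_clause _ _ _ fun h1 h2 => conn_trans h2 h1
  · exact imp_clause _ _ _ fun h1 h2 => conn_trans h1 (conn_symm h2)
  · exact imp_clause _ _ _ fun h1 h2 => conn_trans (conn_symm h2) h1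
  · exact imp_clause _ _ _ fun h1 h2 => conn_trans h2 h1

omit [Fintype E] in
/-- **The state of a copy of the support** when the roots and `a₃` sit behind `c`. -/
theorem st_eq_glued5 {VL VH : Set V} {F : Finset E} {z : Config E}
    (h : CutRootsA3 ends o a₁ a₂ a₃ b c VL VH F z) {x : Config E} (hx : ∀ e, e ∉ F → x e = z e) :
    st ends o a₁ a₂ a₃ b x =
      glued5 (hst5 ends a₁ a₂ a₃ c VH x) (decide (Conn ends (withinRestr ends VL x) c o))
        (decide (Conn ends (withinRestr ends VL x) c b)) := by
  have hsp := CutRootsA3.split_of_le ends o a₁ a₂ a₃ b c h (le_zF hx)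
  have hsp' : ∀ e, x e = true → e ∈ within ends VH ∨ e ∈ within ends VL := fun e he =>
    (hsp e he).symm
  have hcap' : ∀ t, t ∈ VH → t ∈ VL → t = c := fun t h1 h2 => h.cap t h2 h1
  unfold st glued5 hst5 H5.ρ H5.α₁ H5.α₂ H5.lam3 H5.eta3
  have e1 : Conn ends x a₂ a₁ ↔ Conn ends (withinRestr ends VH x) a₁ a₂ := by
    rw [conn_side ends hsp' hcap' h.a2H h.a1H]
    exact ⟨conn_symm, conn_symm⟩
  have e2 : Conn ends x a₁ o ↔
      Conn ends (withinRestr ends VH x) a₁ c ∧ Conn ends (withinRestr ends VL x) c o :=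
    conn_cross ends hsp' hcap' ⟨h.cH, h.cL⟩ h.a1H h.oL h.oc
  have e3 : Conn ends x a₂ o ↔
      Conn ends (withinRestr ends VH x) a₂ c ∧ Conn ends (withinRestr ends VL x) c o :=
    conn_cross ends hsp' hcap' ⟨h.cH, h.cL⟩ h.a2H h.oL h.oc
  have e4 : Conn ends x a₁ b ↔
      Conn ends (withinRestr ends VH x) a₁ c ∧ Conn ends (withinRestr ends VL x) c b :=
    conn_cross ends hsp' hcap' ⟨h.cH, h.cL⟩ h.a1H h.bL h.bc
  have e5 : Conn ends x a₂ b ↔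
      Conn ends (withinRestr ends VH x) a₂ c ∧ Conn ends (withinRestr ends VL x) c b :=
    conn_cross ends hsp' hcap' ⟨h.cH, h.cL⟩ h.a2H h.bL h.bc
  have e6 : Conn ends x a₁ a₃ ↔ Conn ends (withinRestr ends VH x) a₁ a₃ :=
    conn_side ends hsp' hcap' h.a1H h.a3H
  have e7 : Conn ends x a₂ a₃ ↔ Conn ends (withinRestr ends VH x) a₂ a₃ :=
    conn_side ends hsp' hcap' h.a2H h.a3H
  rw [decide_eq_decide.mpr e1, decide_eq_decide.mpr e2, decide_eq_decide.mpr e3,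
    decide_eq_decide.mpr e4, decide_eq_decide.mpr e5, decide_eq_decide.mpr e6,
    decide_eq_decide.mpr e7]
  · simp only [Bool.decide_and]
  all_goals infer_instance

end Support

/-! ## The kernels of the two sides, the factorisation and the theorem -/

section Main

open Classical

variable {V : Type*} {E : Type*} [Fintype E] [DecidableEq E] {R : Type*} [Field R]
  [LinearOrder R] [IsStrictOrderedRing R]
variable (ends : E → Sym2 V) (o a₁ a₂ a₃ b c : V)

/-- A root-side coefficient read on the root side. -/
noncomputable def hK5 (VH : Set V) (C : H5 → H5 → H5 → ℤ) :
    Config E → Config E → Config E → R :=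
  fun x y w => ((C (hst5 ends a₁ a₂ a₃ c VH x) (hst5 ends a₁ a₂ a₃ c VH y)
    (hst5 ends a₁ a₂ a₃ c VH w) : ℤ) : R)

/-- The far-side kernel of the same-copy monomial: `1[b ∈ C(c)] 1[o ∈ C(c)]` in the third copy
(the kernel of `sSame` at the root `c`). -/
noncomputable def lKS : Config E → Config E → Config E → R :=
  fun _ _ w => iL ends c b w * iL ends c o w

/-- The far-side kernel `1[o ∈ C(c)](y) 1[b ∈ C(c)](w)`. -/
noncomputable def lK1' : Config E → Config E → Config E → R :=
  fun _ y w => iL ends c o y * iL ends c b w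

/-- The far-side kernel `1[b ∈ C(c)](y) 1[o ∈ C(c)](w)` (the kernel of `sCross` at the root `c`). -/
noncomputable def lK2' : Config E → Config E → Config E → R :=
  fun _ y w => iL ends c b y * iL ends c o w

/-- The far-side kernel `1[o ∈ C(c)](x) 1[b ∈ C(c)](y)`. -/
noncomputable def lK3' : Config E → Config E → Config E → R :=
  fun x y _ => iL ends c o x * iL ends c b y

omit [Fintype E] [LinearOrder R] [IsStrictOrderedRing R] in
/-- The root-side bits only see the root-side typed edges. -/
lemma hst5_restr (VH : Set V) {F : Finset E} {z x : Config E} (hx : ∀ e, e ∉ F → x e = z e) :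
    hst5 ends a₁ a₂ a₃ c VH (restr (sideF ends VH F) z x) = hst5 ends a₁ a₂ a₃ c VH x := by
  unfold hst5
  rw [withinRestr_restr_eq ends VH hx]

omit [Fintype E] [LinearOrder R] [IsStrictOrderedRing R] in
/-- `1[v ∈ C(c)]` of the far-side restriction is the far-side connection, as `ind`. -/
lemma iL_side5 {VL VH : Set V} {F : Finset E} {z : Config E}
    (h : CutRootsA3 ends o a₁ a₂ a₃ b c VL VH F z) {x : Config E} (hx : ∀ e, e ∉ F → x e = z e)
    (v : V) (hv : v ∈ VL) :
    iL ends c v (restr (sideF ends VL F) z x) =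
      ((ind (decide (Conn ends (withinRestr ends VL x) c v)) : ℤ) : R) := by
  have hsp := CutRootsA3.split_of_le ends o a₁ a₂ a₃ b c h
    (restr_le_zF (sideF ends VL F) hx)
  have e := conn_side ends hsp h.cap h.cL hv (x := restr (sideF ends VL F) z x)
  rw [withinRestr_restr_eq ends VL hx] at e
  rw [iL_eq_dec]
  by_cases hc : Conn ends (withinRestr ends VL x) c v
  · have hc' := e.mpr hc
    simp [hc, hc', ind]
  · have hc' : ¬ Conn ends (restr (sideF ends VL F) z x) c v := fun h' => hc (e.mp h')
    simp [hc, hc', ind]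

omit [Fintype E] [LinearOrder R] [IsStrictOrderedRing R] in
/-- **`K₃` on the support** when the roots and `a₃` sit behind `c`: the four-monomial expansion. -/
theorem K3_eq_cutRootsA3 {VL VH : Set V} {F : Finset E} {z : Config E}
    (h : CutRootsA3 ends o a₁ a₂ a₃ b c VL VH F z) {x y w : Config E}
    (hx : ∀ e, e ∉ F → x e = z e) (hy : ∀ e, e ∉ F → y e = z e) (hw : ∀ e, e ∉ F → w e = z e) :
    (K3 ends o a₁ a₂ a₃ b x y w : R) =
      lKS ends o b c (restr (sideF ends VL F) z x) (restr (sideF ends VL F) z y)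
          (restr (sideF ends VL F) z w) *
        hK5 ends a₁ a₂ a₃ c VH cS (restr (sideF ends VH F) z x) (restr (sideF ends VH F) z y)
          (restr (sideF ends VH F) z w) +
      lK1' ends o b c (restr (sideF ends VL F) z x) (restr (sideF ends VL F) z y)
          (restr (sideF ends VL F) z w) *
        hK5 ends a₁ a₂ a₃ c VH c1 (restr (sideF ends VH F) z x) (restr (sideF ends VH F) z y)
          (restr (sideF ends VH F) z w) +
      lK2' ends o b c (restr (sideF ends VL F) z x) (restr (sideF ends VL F) z y)
          (restr (sideF ends VL F) z w) *
        hK5 ends a₁ a₂ a₃ c VH c2 (restr (sideF ends VH F) z x) (restr (sideF ends VH F) z y)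
          (restr (sideF ends VH F) z w) +
      lK3' ends o b c (restr (sideF ends VL F) z x) (restr (sideF ends VL F) z y)
          (restr (sideF ends VL F) z w) *
        hK5 ends a₁ a₂ a₃ c VH c3 (restr (sideF ends VH F) z x) (restr (sideF ends VH F) z y)
          (restr (sideF ends VH F) z w) := by
  rw [K3_eq_KB, st_eq_glued5 ends o a₁ a₂ a₃ b c h hx, st_eq_glued5 ends o a₁ a₂ a₃ b c h hy,
    st_eq_glued5 ends o a₁ a₂ a₃ b c h hw, KB_glued5]
  unfold hK5 lKS lK1' lK2' lK3'
  rw [hst5_restr ends a₁ a₂ a₃ c VH hx, hst5_restr ends a₁ a₂ a₃ c VH hy,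
    hst5_restr ends a₁ a₂ a₃ c VH hw]
  simp only [iL_side5 ends o a₁ a₂ a₃ b c h hx o h.oL,
    iL_side5 ends o a₁ a₂ a₃ b c h hy o h.oL, iL_side5 ends o a₁ a₂ a₃ b c h hy b h.bL,
    iL_side5 ends o a₁ a₂ a₃ b c h hw o h.oL, iL_side5 ends o a₁ a₂ a₃ b c h hw b h.bL]
  push_cast
  ring

omit [LinearOrder R] [IsStrictOrderedRing R] in
/-- The three cross far-side counts are `sCross` at the root `c`. -/
lemma count_lK1'_eq (A : Finset E) (z : Config E) (τ : E → ℕ) (hτ : ∀ e ∈ A, τ e = 1 ∨ τ e = 2) :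
    typedCount A z τ (lK1' ends o b c : Config E → Config E → Config E → R) =
      sCross (R := R) ends o c b A z τ := by
  unfold sCross
  rw [← typedCount_swap23 A z τ hτ (lK1' ends o b c)]
  exact typedCount_congr' _ _ _ _ _ fun x y w => by unfold lK1'; ring

omit [LinearOrder R] [IsStrictOrderedRing R] in
/-- The third cross count is `sCross` at the root `c`. -/
lemma count_lK3'_eq (A : Finset E) (z : Config E) (τ : E → ℕ) (hτ : ∀ e ∈ A, τ e = 1 ∨ τ e = 2) :
    typedCount A z τ (lK3' ends o b c : Config E → Config E → Config E → R) =
      sCross (R := R) ends o c b A z τ := by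
  unfold sCross
  rw [← typedCount_swap13 A z τ hτ (lK3' ends o b c)]
  exact typedCount_congr' _ _ _ _ _ fun x y w => by unfold lK3'; ring

/-- The root-side count of the same-copy coefficient is nonnegative (`symS_nonneg`). -/
theorem count_cS_nonneg (VH : Set V) (B : Finset E) (z : Config E) (τ : E → ℕ)
    (hτ : ∀ e ∈ B, τ e = 1 ∨ τ e = 2) :
    0 ≤ typedCount B z τ (hK5 ends a₁ a₂ a₃ c VH cS : Config E → Config E → Config E → R) := by
  have h6 := six_mul_typedCount B z τ hτ
    (hK5 ends a₁ a₂ a₃ c VH cS : Config E → Config E → Config E → R)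
  have hpos : 0 ≤ typedCount B z τ (fun x y w => (hK5 ends a₁ a₂ a₃ c VH cS x y w : R) +
      hK5 ends a₁ a₂ a₃ c VH cS x w y + hK5 ends a₁ a₂ a₃ c VH cS y x w +
      hK5 ends a₁ a₂ a₃ c VH cS y w x + hK5 ends a₁ a₂ a₃ c VH cS w x y +
      hK5 ends a₁ a₂ a₃ c VH cS w y x) := by
    refine typedCount_nonneg_of_nonneg _ _ _ fun x y w => ?_
    have h0 := symS_nonneg (hst5 ends a₁ a₂ a₃ c VH x) (hst5 ends a₁ a₂ a₃ c VH y)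
      (hst5 ends a₁ a₂ a₃ c VH w) (hst5_valid ends a₁ a₂ a₃ c VH x)
      (hst5_valid ends a₁ a₂ a₃ c VH y) (hst5_valid ends a₁ a₂ a₃ c VH w)
    unfold sym5 at h0
    unfold hK5
    exact_mod_cast h0
  have : (0 : R) ≤ 6 * typedCount B z τ
      (hK5 ends a₁ a₂ a₃ c VH cS : Config E → Config E → Config E → R) := by
    rw [h6]; exact hpos
  linarith

/-- The root-side count of the sum of all four coefficients is nonnegative
(`symS_add_symC_nonneg`). -/
theorem count_sum_nonneg (VH : Set V) (B : Finset E) (z : Config E) (τ : E → ℕ)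
    (hτ : ∀ e ∈ B, τ e = 1 ∨ τ e = 2) :
    0 ≤ typedCount B z τ (hK5 ends a₁ a₂ a₃ c VH cS : Config E → Config E → Config E → R) +
      (typedCount B z τ (hK5 ends a₁ a₂ a₃ c VH c1) + typedCount B z τ (hK5 ends a₁ a₂ a₃ c VH c2) +
        typedCount B z τ (hK5 ends a₁ a₂ a₃ c VH c3)) := by
  rw [← typedCount_add', ← typedCount_add', ← typedCount_add']
  set K : Config E → Config E → Config E → R := fun x y w =>
    hK5 ends a₁ a₂ a₃ c VH cS x y w + (hK5 ends a₁ a₂ a₃ c VH c1 x y w +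
      hK5 ends a₁ a₂ a₃ c VH c2 x y w + hK5 ends a₁ a₂ a₃ c VH c3 x y w) with hK
  have h6 := six_mul_typedCount B z τ hτ K
  have hpos : 0 ≤ typedCount B z τ (fun x y w =>
      K x y w + K x w y + K y x w + K y w x + K w x y + K w y x) := by
    refine typedCount_nonneg_of_nonneg _ _ _ fun x y w => ?_
    have h0 := symS_add_symC_nonneg (hst5 ends a₁ a₂ a₃ c VH x) (hst5 ends a₁ a₂ a₃ c VH y)
      (hst5 ends a₁ a₂ a₃ c VH w) (hst5_valid ends a₁ a₂ a₃ c VH x)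
      (hst5_valid ends a₁ a₂ a₃ c VH y) (hst5_valid ends a₁ a₂ a₃ c VH w)
    have hcast : K x y w + K x w y + K y x w + K y w x + K w x y + K w y x =
        ((sym5 cS (hst5 ends a₁ a₂ a₃ c VH x) (hst5 ends a₁ a₂ a₃ c VH y)
            (hst5 ends a₁ a₂ a₃ c VH w) +
          (sym5 c1 (hst5 ends a₁ a₂ a₃ c VH x) (hst5 ends a₁ a₂ a₃ c VH y)
              (hst5 ends a₁ a₂ a₃ c VH w) +
            sym5 c2 (hst5 ends a₁ a₂ a₃ c VH x) (hst5 ends a₁ a₂ a₃ c VH y)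
              (hst5 ends a₁ a₂ a₃ c VH w) +
            sym5 c3 (hst5 ends a₁ a₂ a₃ c VH x) (hst5 ends a₁ a₂ a₃ c VH y)
              (hst5 ends a₁ a₂ a₃ c VH w)) : ℤ) : R) := by
      simp only [hK, hK5, sym5]
      push_cast
      ring
    rw [hcast]
    exact_mod_cast h0
  have : (0 : R) ≤ 6 * typedCount B z τ K := by
    rw [h6]; exact hpos
  linarith

omit [LinearOrder R] [IsStrictOrderedRing R] in
/-- **The identity**: `typedCount F z τ K₃ = [cHS · S_same + (cH1 + cH2 + cH3) · S_cross] · (inert)`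
when the roots and `a₃` sit behind the unmarked cut vertex `c`. -/
theorem typedCount_eq_cutRootsA3 {VL VH : Set V} (F : Finset E) (z : Config E) (τ : E → ℕ)
    (hτ : ∀ e ∈ F, τ e = 1 ∨ τ e = 2) (h : CutRootsA3 ends o a₁ a₂ a₃ b c VL VH F z) :
    typedCount F z τ (K3 ends o a₁ a₂ a₃ b : Config E → Config E → Config E → R) =
      (typedCount (sideF ends VH F) z τ
          (hK5 ends a₁ a₂ a₃ c VH cS : Config E → Config E → Config E → R) *
          sSame (R := R) ends o c b (sideF ends VL F) z τ +
        (typedCount (sideF ends VH F) z τ (hK5 ends a₁ a₂ a₃ c VH c1) +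
          typedCount (sideF ends VH F) z τ (hK5 ends a₁ a₂ a₃ c VH c2) +
          typedCount (sideF ends VH F) z τ (hK5 ends a₁ a₂ a₃ c VH c3)) *
          sCross (R := R) ends o c b (sideF ends VL F) z τ) *
        typedCount (F \ (sideF ends VL F ∪ sideF ends VH F)) z τ (fun _ _ _ => (1 : R)) := by
  set A := sideF ends VL F with hA
  set B := sideF ends VH F with hB
  set C := F \ (A ∪ B) with hC
  have hAF : A ⊆ F := Finset.filter_subset _ _
  have hBF : B ⊆ F := Finset.filter_subset _ _
  have hAB : Disjoint A B := by
    rw [Finset.disjoint_left]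
    intro e heA heB
    simp only [hA, hB, sideF, Finset.mem_filter] at heA heB
    exact h.noloop e heA.1 ⟨heA.2, heB.2⟩
  have hABF : A ∪ B ⊆ F := Finset.union_subset hAF hBF
  have hAC : Disjoint A C := Finset.disjoint_of_subset_left Finset.subset_union_left Finset.disjoint_sdiff
  have hBC : Disjoint B C := Finset.disjoint_of_subset_left Finset.subset_union_right Finset.disjoint_sdiff
  have hF : A ∪ B ∪ C = F := Finset.union_sdiff_of_subset hABF
  have hτA : ∀ e ∈ A, τ e = 1 ∨ τ e = 2 := fun e he => hτ e (hAF he)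
  have hker : typedCount F z τ (K3 ends o a₁ a₂ a₃ b : Config E → Config E → Config E → R) =
      typedCount F z τ (fun x y w =>
        lKS ends o b c (restr A z x) (restr A z y) (restr A z w) *
            hK5 ends a₁ a₂ a₃ c VH cS (restr B z x) (restr B z y) (restr B z w) +
          lK1' ends o b c (restr A z x) (restr A z y) (restr A z w) *
            hK5 ends a₁ a₂ a₃ c VH c1 (restr B z x) (restr B z y) (restr B z w) +
          lK2' ends o b c (restr A z x) (restr A z y) (restr A z w) *
            hK5 ends a₁ a₂ a₃ c VH c2 (restr B z x) (restr B z y) (restr B z w) +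
          lK3' ends o b c (restr A z x) (restr A z y) (restr A z w) *
            hK5 ends a₁ a₂ a₃ c VH c3 (restr B z x) (restr B z y) (restr B z w)) := by
    refine typedCount_congr_on_support F z τ fun x y w hc _ => ?_
    exact K3_eq_cutRootsA3 ends o a₁ a₂ a₃ b c h (fun e he => (hc e he).1)
      (fun e he => (hc e he).2.1) (fun e he => (hc e he).2.2)
  rw [hker, typedCount_add4]
  have h1 := typedCount_mul_three A B C hAB hAC hBC z τ (lKS ends o b c)
    (hK5 ends a₁ a₂ a₃ c VH cS : Config E → Config E → Config E → R)
  have h2 := typedCount_mul_three A B C hAB hAC hBC z τ (lK1' ends o b c)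
    (hK5 ends a₁ a₂ a₃ c VH c1 : Config E → Config E → Config E → R)
  have h3 := typedCount_mul_three A B C hAB hAC hBC z τ (lK2' ends o b c)
    (hK5 ends a₁ a₂ a₃ c VH c2 : Config E → Config E → Config E → R)
  have h4 := typedCount_mul_three A B C hAB hAC hBC z τ (lK3' ends o b c)
    (hK5 ends a₁ a₂ a₃ c VH c3 : Config E → Config E → Config E → R)
  rw [hF] at h1 h2 h3 h4
  rw [h1, h2, h3, h4, count_lK1'_eq ends o b c A z τ hτA, count_lK3'_eq ends o b c A z τ hτA]
  unfold sSame sCross lKS lK2'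
  ring

/-- **Row 2′TRI when an unmarked cut vertex separates the roots and `a₃` from `{o, b}`**
(`P3-BRIDGE.md` §11.7), for every pinning and every type map with values in `{1, 2}`: typed
Harris on the far side at the root `c`, signs on the root side. -/
theorem typedCount_nonneg_of_cutRootsA3 {VL VH : Set V} (F : Finset E) (z : Config E)
    (τ : E → ℕ) (hτ : ∀ e ∈ F, τ e = 1 ∨ τ e = 2)
    (h : CutRootsA3 ends o a₁ a₂ a₃ b c VL VH F z) :
    0 ≤ typedCount F z τ (K3 ends o a₁ a₂ a₃ b : Config E → Config E → Config E → R) := by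
  rw [typedCount_eq_cutRootsA3 ends o a₁ a₂ a₃ b c F z τ hτ h]
  have hτA : ∀ e ∈ sideF ends VL F, τ e = 1 ∨ τ e = 2 :=
    fun e he => hτ e (Finset.filter_subset _ _ he)
  have hτB : ∀ e ∈ sideF ends VH F, τ e = 1 ∨ τ e = 2 :=
    fun e he => hτ e (Finset.filter_subset _ _ he)
  have hS := sSame_sub_sCross_nonneg (R := R) ends o c b (sideF ends VL F) z τ hτA
  have hX : (0 : R) ≤ sCross (R := R) ends o c b (sideF ends VL F) z τ := by
    unfold sCross
    refine typedCount_nonneg_of_nonneg _ _ _ fun x y w => ?_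
    unfold iL
    exact mul_nonneg (Set.indicator_nonneg (fun _ _ => zero_le_one) _)
      (Set.indicator_nonneg (fun _ _ => zero_le_one) _)
  have hC := count_cS_nonneg (R := R) ends a₁ a₂ a₃ c VH (sideF ends VH F) z τ hτB
  have hT := count_sum_nonneg (R := R) ends a₁ a₂ a₃ c VH (sideF ends VH F) z τ hτB
  have hI : (0 : R) ≤ typedCount (F \ (sideF ends VL F ∪ sideF ends VH F)) z τ
      (fun _ _ _ => (1 : R)) :=
    typedCount_nonneg_of_nonneg _ _ _ fun _ _ _ => zero_le_one
  refine mul_nonneg ?_ hI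
  nlinarith [mul_nonneg hC hS, mul_nonneg hT hX]

/-- **The class of the typed graph `(V, F)`**: an unmarked vertex `c` is a cut vertex of `(V, F)`
separating `{a₁, a₂, a₃}` from `{o, b}`. -/
def HasCutRootsA3 (F : Finset E) : Prop :=
  ∃ (c : V) (VL VH : Set V), CutRootsA3 ends o a₁ a₂ a₃ b c VL VH F (fun _ => false)

/-- **Row 2′TRI on the class at `z ≡ false`** — a conjunct for the residual domain. -/
theorem typedCount_nonneg_of_hasCutRootsA3 (F : Finset E) (τ : E → ℕ)
    (hτ : ∀ e ∈ F, τ e = 1 ∨ τ e = 2) (h : HasCutRootsA3 ends o a₁ a₂ a₃ b F) :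
    0 ≤ typedCount F (fun _ => false) τ (K3 ends o a₁ a₂ a₃ b : Config E → Config E → Config E → R) := by
  obtain ⟨c, VL, VH, hc⟩ := h
  exact typedCount_nonneg_of_cutRootsA3 ends o a₁ a₂ a₃ b c F _ τ hτ hc

end Main

end RootBridge

end CovForm

end Summit.Ventures.PercRepro2
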